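import Mathlib
import HarnessLib
import Summits.Ventures.LatticeQCDFlow.Exactness.SUNLeapfrogHMCUniformMinorant
import Summits.Ventures.LatticeQCDFlow.Exactness.SUNJitteredHMCMeasurableLabels

/-!
# The engine's jittered `SU(N)` HMC with an ATOMLESS jitter law converges from every start — certificates whenever the law of the trajectory length charges a short interval

HONEST FRAMING: exact (Metropolis-corrected) sampling algorithms for lattice gauge theory;
figures of merit are autocorrelation/cost numbers at stated couplings and volumes; no
continuum-physics claim.

Venture `LatticeQCDFlow` (cell pub-lqcd), topic `Exactness`, FANOUT row 9 (eng-latcore, GEN-24; the engine's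
`latflow.core.hmc.HMC.trajectory(rng, τ, nstep, tau_jitter = j)` and `composite_sweep(f, β, 'hmc', n_or)`).
NEW WORK of the cell over GEN-24's `SUNLeapfrogHMCUniformMinorant.lean` (ONE box minorant for every trajectory
length in `[τ₁, τ₂] ⊂ (0, τ₀]`: `engine_sunLeapfrogHMCN_box_minorised_uniform_of_trajLength`) and
`SUNJitteredHMCMeasurableLabels.lean` (the engine kernel `wilsonJitterHMCL N d L β nstep η` for a general Borel
law `η` of the trajectory LENGTH, exact for every `η`; `smul_le_wilsonJitterHMCL_of_common_minorant`), with the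
tree's `SUNJitteredHMCCertificates.exactStep_nHit_minorised_of_box_minorised`,
`ExactStepBoxMinorised.exactStep_uniformlyErgodic_of_box_minorised`, `CabibboMarinariORSweep.cmORSweep_invariant`,
`SUNWilsonForceLaw` (`sunWilsonForceLaw_bounds`, `exists_bound_smul_wilsonAction_sun`, `gibbsWeight_pinched`,
`gibbsProbability_smul_wilsonAction_eq`).  Nothing is cited as a fact; no number is claimed.

WHY.  Every convergence statement of the tree for `tau_jitter` (GEN-22 `SUNJitteredHMCExactStep.lean`, GEN-23
`SUNJitteredHMCCertificates.lean`) asks for an ATOM `l₀` of the jitter law with a short trajectory and pays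
`η{l₀}` in the constant; for the code's 53-bit uniform that is `2⁻⁵³`, and for the idealised uniform law there is no
atom at all.  Here the hypothesis is the natural one: the law of the drawn trajectory length gives positive mass to
SOME interval `[τ₁, τ₂]` of short lengths (`0 < τ₁ ≤ τ₂ ≤ τ₀`), and the constant carries `η[τ₁, τ₂]` instead.

## Content (torus `(ℤ/L)^d`, `SU(N)`, any real `β`, the engine's momenta / kinetic term / Wilson force law /
Metropolis test; `K = wilsonJitterHMCL N d L β nstep η`, `η` a Borel probability law on `ℝ` of the trajectory length,
`nstep ≥ 1` fixed; `τ₀ > 0` depends on `N, d, L, β` only and is not computed)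

* §1 **`wilsonJitterHMCL_box_minorised`** — for every `0 < τ₁ ≤ τ₂ ≤ τ₀` ONE open `V ∋ 1` and `κ ≠ 0` with
  `(η[τ₁, τ₂] · κ) • Haar^{⊗E}|_{box_V(U)} ≤ K(U, ·)` for EVERY law `η` and EVERY `U`.
* §2 **`wilsonJitterHMCL_exactStep_certificate`** — if `η[τ₁, τ₂] ≠ 0`, then for EVERY Markov kernel `P` leaving
  `wilsonMeasure (β/N)` invariant, `P ∘ₖ K` leaves it invariant and `ε' • wilsonMeasure (β/N) ≤ (P ∘ₖ K)^m(U, ·)` for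
  EVERY `U` (`m > 0`, `0 < ε' ≤ 1`) — the certificate rows 8/13/21's `…_of_nHit` theorems consume;
  **`wilsonJitterHMCL_certificate`** (`P = id`: the jittered update alone); **`wilsonJitterHMCL_orSweep_certificate`**
  (`P` = ANY schedule of Cabibbo–Marinari over-relaxation hits, `L ≥ 2`: THE ENGINE'S `'hmc'(tau_jitter) + n_or × 'or'`).
* §3 **`wilsonJitterHMCL_exactStep_uniformlyErgodic`** / **`wilsonJitterHMCL_orSweep_uniformlyErgodic`** —
  `|μ₀ (P ∘ₖ K)ᵗ(A) − wilsonMeasure (β/N)(A)| ≤ (1 − δ)^{⌊t/(mm+1)⌋}` from EVERY initial law, and the Wilson measure is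
  the unique invariant probability law of `P ∘ₖ K`.

Reading for the engine (value-free): with `tau_jitter = j` the drawn length is uniform on `[τ(1−j), τ(1+j)]`; that
law charges a short interval iff `τ(1 − j) < τ₀` — in particular `j = 1` qualifies at EVERY production length `τ`
(the instance with the uniform law is the next file).  NOT CLAIMED: anything when the law puts no mass below `τ₀`
(long trajectories only); any value of `τ₀`, `m`, `ε'`, `δ`; OMF words; floating point.
-/

noncomputable section

namespace Summit.Ventures.LatticeQCDFlow.Exactness

open MeasureTheory ProbabilityTheory ProbabilityTheory.Kernel Set Metric Function Filter Topology
open Literature.MathematicalPhysics.QuantumFieldTheory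
open Literature.MathematicalPhysics.QuantumLattice (fundamentalRep continuous_fundamentalRep connectedSpace_specialUnitaryGroup)
open scoped ENNReal Matrix Matrix.Norms.Operator NNReal

set_option backward.isDefEq.respectTransparency false

section Atomless

variable {N d L : ℕ} [NeZero N] [NeZero L] (β : ℝ)

/-! ## §1 The jittered engine kernel is box-minorised with the factor `η[τ₁, τ₂]` -/

/-- **`(η[τ₁, τ₂] · κ) • Haar^{⊗E}|_{box_V(U)} ≤ K(U, ·)` FOR EVERY LAW `η` OF THE LENGTH AND EVERY `U`**, with ONE
`(V, κ)` per short interval `[τ₁, τ₂]`: there is `τ₀ > 0` (on `N, d, L, β` only) such that for every `nstep ≥ 1` and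
every `0 < τ₁ ≤ τ₂ ≤ τ₀` some open `V ∋ 1` and `κ ≠ 0` serve every s-finite `η` and every `U`. -/
theorem wilsonJitterHMCL_box_minorised :
    ∃ τ₀ : ℝ, 0 < τ₀ ∧ ∀ (nstep : ℕ) (τ₁ τ₂ : ℝ), 1 ≤ nstep → 0 < τ₁ → τ₁ ≤ τ₂ → τ₂ ≤ τ₀ →
      ∃ V : Set (Matrix.specialUnitaryGroup (Fin N) ℂ), IsOpen V ∧ (1 : Matrix.specialUnitaryGroup (Fin N) ℂ) ∈ V ∧
        ∃ κ : ℝ≥0∞, κ ≠ 0 ∧ ∀ (η : Measure ℝ) [SFinite η] (U : GaugeConfig d L (Matrix.specialUnitaryGroup (Fin N) ℂ)),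
          (η (Icc τ₁ τ₂) * κ) •
              (Measure.pi fun _ : Edge d L => haarProbability (Matrix.specialUnitaryGroup (Fin N) ℂ)).restrict
                {W | ∀ j, W j * (U j)⁻¹ ∈ V} ≤
            wilsonJitterHMCL N d L β nstep η U := by
  obtain ⟨s, hs⟩ := exists_bound_smul_wilsonAction_sun N (d := d) (L := L) _ (continuous_fundamentalRep (Fin N)) (β / N)
  obtain ⟨Fmax, KF, hF0, hKF0, hFb, hFK⟩ := sunWilsonForceLaw_bounds N (d := d) (L := L) β
  obtain ⟨τ₀, hτ₀, hbox⟩ := engine_sunLeapfrogHMCN_box_minorised_uniform_of_trajLength N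
    (measurable_sunWilsonForceLaw_coeConfig N (d := d) (L := L) β) hF0 hFb hKF0 hFK (measurable_engineWilsonAction N β) hs
  refine ⟨τ₀, hτ₀, fun nstep τ₁ τ₂ hn hτ₁ h12 hτ₂ => ?_⟩
  obtain ⟨V, hVo, hV1, κ, hκ, hK⟩ := hbox nstep τ₁ τ₂ hn hτ₁ h12 hτ₂
  refine ⟨V, hVo, hV1, κ, hκ, fun η _ U => ?_⟩
  rw [← smul_smul]
  exact smul_le_wilsonJitterHMCL_of_common_minorant (N := N) (d := d) (L := L) β nstep η measurableSet_Icc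
    (W := fun U => κ • (Measure.pi fun _ : Edge d L => haarProbability (Matrix.specialUnitaryGroup (Fin N) ℂ)).restrict
      {W | ∀ j, W j * (U j)⁻¹ ∈ V}) (fun τ' hτ' U => hK τ' hτ' U) U

/-! ## §2 The certificates -/

/-- **THE DOEBLIN CERTIFICATE OF THE JITTERED ENGINE HMC (GENERAL LAW OF THE LENGTH) FOLLOWED BY ANY EXACT STEP.**
There is `τ₀ > 0` (on `N, d, L, β` only) such that for EVERY `nstep ≥ 1`, EVERY `0 < τ₁ ≤ τ₂ ≤ τ₀`, EVERY Borel
probability law `η` of the trajectory length with `η[τ₁, τ₂] ≠ 0` — atomless laws included — and EVERY Markov kernel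
`P` leaving `wilsonMeasure (β/N)` invariant: `P ∘ₖ K` leaves `wilsonMeasure (β/N)` invariant and some power of it
dominates `ε' · wilsonMeasure (β/N)` from EVERY configuration (`m > 0`, `0 < ε' ≤ 1`). -/
theorem wilsonJitterHMCL_exactStep_certificate :
    ∃ τ₀ : ℝ, 0 < τ₀ ∧ ∀ (nstep : ℕ) (τ₁ τ₂ : ℝ) (η : Measure ℝ) [IsProbabilityMeasure η],
      1 ≤ nstep → 0 < τ₁ → τ₁ ≤ τ₂ → τ₂ ≤ τ₀ → η (Icc τ₁ τ₂) ≠ 0 →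
      ∀ (P : Kernel (GaugeConfig d L (Matrix.specialUnitaryGroup (Fin N) ℂ))
          (GaugeConfig d L (Matrix.specialUnitaryGroup (Fin N) ℂ))) [IsMarkovKernel P],
        Invariant P (wilsonMeasure (d := d) (L := L) (fundamentalRep (Fin N)) (β / N)) →
      Invariant (P ∘ₖ wilsonJitterHMCL N d L β nstep η) (wilsonMeasure (d := d) (L := L) (fundamentalRep (Fin N)) (β / N)) ∧
      ∃ m : ℕ, ∃ ε' : ℝ≥0∞, 0 < m ∧ 0 < ε' ∧ ε' ≤ 1 ∧
        ∀ U : GaugeConfig d L (Matrix.specialUnitaryGroup (Fin N) ℂ),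
          ε' • wilsonMeasure (d := d) (L := L) (fundamentalRep (Fin N)) (β / N) ≤
            nHit (P ∘ₖ wilsonJitterHMCL N d L β nstep η) m U := by
  haveI : ConnectedSpace (Matrix.specialUnitaryGroup (Fin N) ℂ) := connectedSpace_specialUnitaryGroup
  obtain ⟨s, hs⟩ := exists_bound_smul_wilsonAction_sun N (d := d) (L := L) _ (continuous_fundamentalRep (Fin N)) (β / N)
  obtain ⟨τ₀, hτ₀, hbox⟩ := wilsonJitterHMCL_box_minorised (N := N) (d := d) (L := L) β
  refine ⟨τ₀, hτ₀, fun nstep τ₁ τ₂ η _ hn hτ₁ h12 hτ₂ hη P _ hP => ?_⟩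
  obtain ⟨V, hVo, hV1, κ, hκ, hK⟩ := hbox nstep τ₁ τ₂ hn hτ₁ h12 hτ₂
  have hKinv := wilsonJitterHMCL_invariant (N := N) (d := d) (L := L) β nstep η
  refine ⟨hP.comp hKinv, ?_⟩
  obtain ⟨hlo, hhi⟩ := gibbsWeight_pinched (L := Edge d L) (n := Fin N) hs
  have heq := gibbsProbability_smul_wilsonAction_eq N (d := d) (L := L) (fundamentalRep (Fin N)) (β / N)
  rw [← heq] at hP hKinv
  obtain ⟨mm, a, ha, hmin⟩ := exactStep_nHit_minorised_of_box_minorised (Real.exp_pos (-s)) hlo hhi hVo hV1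
    (mul_ne_zero hη hκ) (hK η) P hP
  rw [heq] at hmin
  haveI : IsMarkovKernel (nHit (P ∘ₖ wilsonJitterHMCL N d L β nstep η) (mm + 1)) := isMarkovKernel_nHit _ _
  have ha1 : a ≤ 1 := by
    have h1 := Measure.le_iff'.1 (hmin fun _ => 1) univ
    rwa [Measure.smul_apply, smul_eq_mul, measure_univ, measure_univ, mul_one] at h1
  exact ⟨mm + 1, a, Nat.succ_pos mm, pos_iff_ne_zero.2 ha, ha1, hmin⟩

/-- **THE DOEBLIN CERTIFICATE OF THE JITTERED ENGINE HMC ALONE** (general law of the length; `P = id`): same `τ₀`;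
`ε' • wilsonMeasure (β/N) ≤ K^m(U, ·)` for every `U` (`m > 0`, `0 < ε' ≤ 1`) whenever `η[τ₁, τ₂] ≠ 0`. -/
theorem wilsonJitterHMCL_certificate :
    ∃ τ₀ : ℝ, 0 < τ₀ ∧ ∀ (nstep : ℕ) (τ₁ τ₂ : ℝ) (η : Measure ℝ) [IsProbabilityMeasure η],
      1 ≤ nstep → 0 < τ₁ → τ₁ ≤ τ₂ → τ₂ ≤ τ₀ → η (Icc τ₁ τ₂) ≠ 0 →
      ∃ m : ℕ, ∃ ε' : ℝ≥0∞, 0 < m ∧ 0 < ε' ∧ ε' ≤ 1 ∧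
        ∀ U : GaugeConfig d L (Matrix.specialUnitaryGroup (Fin N) ℂ),
          ε' • wilsonMeasure (d := d) (L := L) (fundamentalRep (Fin N)) (β / N) ≤
            nHit (wilsonJitterHMCL N d L β nstep η) m U := by
  obtain ⟨τ₀, hτ₀, h⟩ := wilsonJitterHMCL_exactStep_certificate (N := N) (d := d) (L := L) β
  refine ⟨τ₀, hτ₀, fun nstep τ₁ τ₂ η _ hn hτ₁ h12 hτ₂ hη => ?_⟩
  obtain ⟨-, m, ε', hm, hε', hε'1, hmin⟩ := h nstep τ₁ τ₂ η hn hτ₁ h12 hτ₂ hη Kernel.id invariant_id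
  exact ⟨m, ε', hm, hε', hε'1, fun U => by simpa only [Kernel.id_comp] using hmin U⟩

variable {mC : Type*} [Fintype mC] [DecidableEq mC]

/-- **THE DOEBLIN CERTIFICATE OF THE ENGINE'S `'hmc' (tau_jitter, GENERAL LAW OF THE LENGTH) + n_or × 'or'` COMPOSITE
AS RUN** (`L ≥ 2`; `P` = ANY schedule `sched` of Cabibbo–Marinari over-relaxation hits): same `τ₀`; whenever
`η[τ₁, τ₂] ≠ 0` the composite leaves `wilsonMeasure (β/N)` invariant and some power of it dominates
`ε' · wilsonMeasure (β/N)` from EVERY configuration. -/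
theorem wilsonJitterHMCL_orSweep_certificate (hL : 2 ≤ L) :
    ∃ τ₀ : ℝ, 0 < τ₀ ∧ ∀ (nstep : ℕ) (τ₁ τ₂ : ℝ) (η : Measure ℝ) [IsProbabilityMeasure η]
      (sched : List (Edge d L × (Fin N ≃ Fin 2 ⊕ mC))),
      1 ≤ nstep → 0 < τ₁ → τ₁ ≤ τ₂ → τ₂ ≤ τ₀ → η (Icc τ₁ τ₂) ≠ 0 →
      Invariant (cmORSweep sched ∘ₖ wilsonJitterHMCL N d L β nstep η)
          (wilsonMeasure (d := d) (L := L) (fundamentalRep (Fin N)) (β / N)) ∧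
      ∃ m : ℕ, ∃ ε' : ℝ≥0∞, 0 < m ∧ 0 < ε' ∧ ε' ≤ 1 ∧
        ∀ U : GaugeConfig d L (Matrix.specialUnitaryGroup (Fin N) ℂ),
          ε' • wilsonMeasure (d := d) (L := L) (fundamentalRep (Fin N)) (β / N) ≤
            nHit (cmORSweep sched ∘ₖ wilsonJitterHMCL N d L β nstep η) m U := by
  obtain ⟨τ₀, hτ₀, h⟩ := wilsonJitterHMCL_exactStep_certificate (N := N) (d := d) (L := L) β
  refine ⟨τ₀, hτ₀, fun nstep τ₁ τ₂ η _ sched hn hτ₁ h12 hτ₂ hη =>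
    h nstep τ₁ τ₂ η hn hτ₁ h12 hτ₂ hη (cmORSweep sched) ?_⟩
  rw [← gibbsProbability_smul_wilsonAction_eq N (d := d) (L := L) (fundamentalRep (Fin N)) (β / N)]
  refine invariant_gibbsProbability ?_
  have hdens : (fun U : GaugeConfig d L (Matrix.specialUnitaryGroup (Fin N) ℂ) =>
      ENNReal.ofReal (Real.exp (-(β / N * wilsonAction (fundamentalRep (Fin N)) U)))) =
      gibbsDensity fun U : GaugeConfig d L (Matrix.specialUnitaryGroup (Fin N) ℂ) => β / N * wilsonAction (suRep N) U := by
    funext U; rfl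
  rw [hdens]
  exact cmORSweep_invariant (β / N) hL sched

/-! ## §3 Convergence from every start and uniqueness -/

/-- **THE JITTERED ENGINE HMC WITH A GENERAL (POSSIBLY ATOMLESS) LAW OF THE LENGTH, FOLLOWED BY ANY EXACT STEP,
CONVERGES TO THE WILSON MEASURE FROM EVERY START** whenever the law charges a short interval: same `τ₀`; for every
`nstep ≥ 1`, `0 < τ₁ ≤ τ₂ ≤ τ₀`, `η[τ₁, τ₂] ≠ 0` and every Wilson-invariant Markov `P` there are `mm` and `δ ∈ (0, 1]`
with `|μ₀ (P ∘ₖ K)ᵗ(A) − wilsonMeasure (β/N)(A)| ≤ (1 − δ)^{⌊t/(mm+1)⌋}` for EVERY initial law `μ₀`, every `t`, every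
`A`, and the Wilson measure is the unique invariant probability law of `P ∘ₖ K`. -/
theorem wilsonJitterHMCL_exactStep_uniformlyErgodic :
    ∃ τ₀ : ℝ, 0 < τ₀ ∧ ∀ (nstep : ℕ) (τ₁ τ₂ : ℝ) (η : Measure ℝ) [IsProbabilityMeasure η],
      1 ≤ nstep → 0 < τ₁ → τ₁ ≤ τ₂ → τ₂ ≤ τ₀ → η (Icc τ₁ τ₂) ≠ 0 →
      ∀ (P : Kernel (GaugeConfig d L (Matrix.specialUnitaryGroup (Fin N) ℂ))
          (GaugeConfig d L (Matrix.specialUnitaryGroup (Fin N) ℂ))) [IsMarkovKernel P],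
        Invariant P (wilsonMeasure (d := d) (L := L) (fundamentalRep (Fin N)) (β / N)) →
      ∃ mm : ℕ, ∃ δ : ℝ, 0 < δ ∧ δ ≤ 1 ∧
        (∀ (μ₀ : Measure (GaugeConfig d L (Matrix.specialUnitaryGroup (Fin N) ℂ))) [IsProbabilityMeasure μ₀]
          (t : ℕ) (A : Set (GaugeConfig d L (Matrix.specialUnitaryGroup (Fin N) ℂ))),
          |((fun m : Measure (GaugeConfig d L (Matrix.specialUnitaryGroup (Fin N) ℂ)) =>
                m.bind (P ∘ₖ wilsonJitterHMCL N d L β nstep η))^[t] μ₀).real A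
              - (wilsonMeasure (d := d) (L := L) (fundamentalRep (Fin N)) (β / N)).real A| ≤ (1 - δ) ^ (t / (mm + 1))) ∧
        ∀ (π' : Measure (GaugeConfig d L (Matrix.specialUnitaryGroup (Fin N) ℂ))) [IsProbabilityMeasure π'],
          Invariant (P ∘ₖ wilsonJitterHMCL N d L β nstep η) π' →
          π' = wilsonMeasure (d := d) (L := L) (fundamentalRep (Fin N)) (β / N) := by
  haveI : ConnectedSpace (Matrix.specialUnitaryGroup (Fin N) ℂ) := connectedSpace_specialUnitaryGroup
  obtain ⟨s, hs⟩ := exists_bound_smul_wilsonAction_sun N (d := d) (L := L) _ (continuous_fundamentalRep (Fin N)) (β / N)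
  obtain ⟨τ₀, hτ₀, hbox⟩ := wilsonJitterHMCL_box_minorised (N := N) (d := d) (L := L) β
  refine ⟨τ₀, hτ₀, fun nstep τ₁ τ₂ η _ hn hτ₁ h12 hτ₂ hη P _ hP => ?_⟩
  obtain ⟨V, hVo, hV1, κ, hκ, hK⟩ := hbox nstep τ₁ τ₂ hn hτ₁ h12 hτ₂
  have hKinv := wilsonJitterHMCL_invariant (N := N) (d := d) (L := L) β nstep η
  obtain ⟨hlo, hhi⟩ := gibbsWeight_pinched (L := Edge d L) (n := Fin N) hs
  rw [← gibbsProbability_smul_wilsonAction_eq N (d := d) (L := L) (fundamentalRep (Fin N)) (β / N)] at hP hKinv ⊢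
  exact exactStep_uniformlyErgodic_of_box_minorised (Real.exp_pos (-s)) hlo hhi hKinv hVo hV1
    (mul_ne_zero hη hκ) (hK η) P hP

/-- **THE ENGINE'S `'hmc' (tau_jitter, GENERAL LAW OF THE LENGTH) + n_or × 'or'` COMPOSITE AS RUN CONVERGES TO THE
WILSON MEASURE FROM EVERY START** (`L ≥ 2`, any schedule of Cabibbo–Marinari over-relaxation hits) whenever the law
of the length charges a short interval; the Wilson measure is its unique invariant probability law. -/
theorem wilsonJitterHMCL_orSweep_uniformlyErgodic (hL : 2 ≤ L) :
    ∃ τ₀ : ℝ, 0 < τ₀ ∧ ∀ (nstep : ℕ) (τ₁ τ₂ : ℝ) (η : Measure ℝ) [IsProbabilityMeasure η]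
      (sched : List (Edge d L × (Fin N ≃ Fin 2 ⊕ mC))),
      1 ≤ nstep → 0 < τ₁ → τ₁ ≤ τ₂ → τ₂ ≤ τ₀ → η (Icc τ₁ τ₂) ≠ 0 →
      ∃ mm : ℕ, ∃ δ : ℝ, 0 < δ ∧ δ ≤ 1 ∧
        (∀ (μ₀ : Measure (GaugeConfig d L (Matrix.specialUnitaryGroup (Fin N) ℂ))) [IsProbabilityMeasure μ₀]
          (t : ℕ) (A : Set (GaugeConfig d L (Matrix.specialUnitaryGroup (Fin N) ℂ))),
          |((fun μ' : Measure (GaugeConfig d L (Matrix.specialUnitaryGroup (Fin N) ℂ)) =>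
                μ'.bind (cmORSweep sched ∘ₖ wilsonJitterHMCL N d L β nstep η))^[t] μ₀).real A
              - (wilsonMeasure (d := d) (L := L) (fundamentalRep (Fin N)) (β / N)).real A| ≤ (1 - δ) ^ (t / (mm + 1))) ∧
        ∀ (π' : Measure (GaugeConfig d L (Matrix.specialUnitaryGroup (Fin N) ℂ))) [IsProbabilityMeasure π'],
          Invariant (cmORSweep sched ∘ₖ wilsonJitterHMCL N d L β nstep η) π' →
          π' = wilsonMeasure (d := d) (L := L) (fundamentalRep (Fin N)) (β / N) := by
  obtain ⟨τ₀, hτ₀, h⟩ := wilsonJitterHMCL_exactStep_uniformlyErgodic (N := N) (d := d) (L := L) β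
  refine ⟨τ₀, hτ₀, fun nstep τ₁ τ₂ η _ sched hn hτ₁ h12 hτ₂ hη =>
    h nstep τ₁ τ₂ η hn hτ₁ h12 hτ₂ hη (cmORSweep sched) ?_⟩
  rw [← gibbsProbability_smul_wilsonAction_eq N (d := d) (L := L) (fundamentalRep (Fin N)) (β / N)]
  refine invariant_gibbsProbability ?_
  have hdens : (fun U : GaugeConfig d L (Matrix.specialUnitaryGroup (Fin N) ℂ) =>
      ENNReal.ofReal (Real.exp (-(β / N * wilsonAction (fundamentalRep (Fin N)) U)))) =
      gibbsDensity fun U : GaugeConfig d L (Matrix.specialUnitaryGroup (Fin N) ℂ) => β / N * wilsonAction (suRep N) U := by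
    funext U; rfl
  rw [hdens]
  exact cmORSweep_invariant (β / N) hL sched

end Atomless

end Summit.Ventures.LatticeQCDFlow.Exactness
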